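import Summits.NavierStokesRegularity.FunctionalMining.TopEigLaminateField
import Summits.NavierStokesRegularity.FunctionalMining.TopEigHeatRate
import HarnessLib

/-!
# FunctionalMining — a two-mode LAMINATE pushes the rate of Lemma L-λ(4) strictly below the
# single-shell value: `TopEigHeatCoercive 4 c → c ≤ (2637/2957)·16π² < 16π²` (laminate calibration, part 2)

Search for candidate a priori estimates; no regularity claim. Cell `pub-nsfunc`, prove seat
(gen 19). A static kernel calibration of the dictionary's OPEN node `TopEigHeatCoercive q c`
(`c · ∫(λ₁⁺)^q ≤ heatDissipation (∫(λ₁⁺)^q)` on smooth zero-mean divergence-free fields of `T³`,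
`TopEigHeatCoercive.lean`) at `q = 4`; nothing about Navier–Stokes dynamics is asserted.

THE FIELD (part 1, `TopEigLaminateField`): the laminate `u = (F(x₂), 0, 0)`,
`F(s) = sin 2πs − (1/27) sin 6πs`; along its heat line `u + tΔu = (F + tF″)(x₂) e₀` the strain is
planar trace-free and `λ₁(S(u + tΔu))⁴ = (π α + t (2π)²π β)⁴`, `α = F′/(2π)`, `β = F‴/(2π)³`.

WHAT IS PROVED (exact values by `decide +kernel` on the Fourier tables; [ours, calibration]):
* `topEigMoment_line` — `∫(λ₁⁺)⁴(u + tΔu) = gPoly t`, an explicit quartic polynomial in `t` whose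
  coefficients are the monomial integrals `I_ij = ∫ αⁱβʲ`; `I40 = 2957/8748`, `I31 = −293/972`
  (`I40_I31_eq`), so `∫(λ₁⁺)⁴(u) = π⁴·2957/8748 > 0` (`topEigMoment_four_u`);
* `heatDissipation_eq_I31` — by the tree's convexity calibration
  (`TopEig.heatDissipation_topEigMoment_eq`: `heatDissipation` is minus the right derivative along
  the heat line) `heatDissipation (∫(λ₁⁺)⁴) u = −4(2π)²π⁴·I31`, i.e.
  **`heatDissipation (∫(λ₁⁺)⁴) u = (2637/2957)·16π²·∫(λ₁⁺)⁴(u)`** (`heatDissipation_topEigMoment_four_u`;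
  `R₄(u) ≈ 0.8918·16π² = 3.567·4π²`, against the single-shell value `4·4π²` of
  `TopEigHeatCoerciveRate`);
* **`topEigHeatCoercive_four_rate_le : TopEigHeatCoercive 4 c → c ≤ (2637/2957)·(16π²)`**, hence
  `< 16π²` (`topEigHeatCoercive_four_rate_lt`, `not_topEigHeatCoercive_four_of_lt`): at `q = 4` the
  first-shell rate `4π²q` of `TopEig.topEigHeatCoercive_rate_le` is NOT the best constant of Lemma
  L-λ — one-dimensional (laminate) structure already goes below it; the same numbers for the `−λ₃`
  core (`negBotEigHeatCoercive_four_rate_le/lt`; `λ(−A)⁴ = λ(A)⁴` on planar tensors);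
* in the dictionary's constant `C_λ(q) = TopEig.topEigHeatRate q` (`TopEigHeatRate.lean`):
  **`topEigHeatRate_four_le : C_λ(4) ≤ (2637/2957)·16π²`**, `topEigHeatRate_four_lt : C_λ(4) < 16π²`,
  and the KERNEL WINDOW `topEigHeatRate_four_mem_Icc : C_λ(4) ∈ [0, (2637/2957)·16π²]`
  (`θ_λ(4) = C_λ(4)/(16π²) ≤ 2637/2957 ≈ 0.8918`).

REMARKS (prose, not used). For a unidirectional laminate with profile `F` the computation reads
`R₄ = 12∫F′²F″²/∫F′⁴` (integration by parts): `= 4·4π²` for a single mode, `= (10548/2957)·4π²`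
here; at `q = 2` the same computation gives `R₂ = 2∫F″²/∫F′² ≥ 2·4π²` (Wirtinger), so laminates
cannot go below the shell value at `q = 2` (nogo SIEVELD §3.4b (4b)(i)); the nogo seat's 3-D descent
records `inf R₄ ≤ 1.018·4π²` numerically — nothing that sharp is claimed here. Kernel window for the
best rate `C_λ(4)`: `[0, (2637/2957)·16π²]` (lower end `TopEigHeatStable`).
-/


noncomputable section

open MeasureTheory Complex UnitAddTorus Set

namespace Summit.NavierStokesRegularity.FunctionalMining

open Literature.Analysis Literature.Analysis.FunctionSpaces Literature.Analysis.FunctionSpaces.Torus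
  Literature.Analysis.FluidPDE
open TrigPolyExact TrigPolyExact.TP TopEig PlanarTopEig PlanarShadow StrainL4

namespace TopEigLaminate

/-! ## 4. The moments along the heat line: a quartic polynomial in `t` -/

/-- `α`, `β` are continuous. [ours; bookkeeping] -/
theorem continuous_αβ : Continuous α ∧ Continuous β :=
  ⟨(isSmooth_evalR _).continuous, (isSmooth_evalR _).continuous⟩

/-- Binomial expansion under the integral sign. [folklore] -/
theorem integral_add_mul_pow_four {f g : UnitAddTorus (Fin 3) → ℝ} (hf : Continuous f) (hg : Continuous g)
    (s : ℝ) :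
    ∫ x, (f x + s * g x) ^ 4 =
      (∫ x, f x ^ 4) + 4 * s * (∫ x, f x ^ 3 * g x) + 6 * s ^ 2 * (∫ x, f x ^ 2 * g x ^ 2) +
        4 * s ^ 3 * (∫ x, f x * g x ^ 3) + s ^ 4 * (∫ x, g x ^ 4) := by
  have e : ∀ x, (f x + s * g x) ^ 4 = f x ^ 4 + 4 * s * (f x ^ 3 * g x) +
      6 * s ^ 2 * (f x ^ 2 * g x ^ 2) + 4 * s ^ 3 * (f x * g x ^ 3) + s ^ 4 * g x ^ 4 := fun x => by ring
  simp_rw [e]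
  have i1 : Integrable (fun x => f x ^ 4) := (hf.pow 4).integrable_unitAddTorus
  have i2 : Integrable (fun x => 4 * s * (f x ^ 3 * g x)) :=
    (continuous_const.mul ((hf.pow 3).mul hg)).integrable_unitAddTorus
  have i3 : Integrable (fun x => 6 * s ^ 2 * (f x ^ 2 * g x ^ 2)) :=
    (continuous_const.mul ((hf.pow 2).mul (hg.pow 2))).integrable_unitAddTorus
  have i4 : Integrable (fun x => 4 * s ^ 3 * (f x * g x ^ 3)) :=
    (continuous_const.mul (hf.mul (hg.pow 3))).integrable_unitAddTorus
  have i5 : Integrable (fun x => s ^ 4 * g x ^ 4) := (continuous_const.mul (hg.pow 4)).integrable_unitAddTorus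
  have i12 : Integrable (fun x => f x ^ 4 + 4 * s * (f x ^ 3 * g x)) := i1.add i2
  have i123 : Integrable (fun x => f x ^ 4 + 4 * s * (f x ^ 3 * g x) + 6 * s ^ 2 * (f x ^ 2 * g x ^ 2)) :=
    i12.add i3
  have i1234 : Integrable (fun x => f x ^ 4 + 4 * s * (f x ^ 3 * g x) + 6 * s ^ 2 * (f x ^ 2 * g x ^ 2) +
      4 * s ^ 3 * (f x * g x ^ 3)) := i123.add i4
  rw [integral_add i1234 i5, integral_add i123 i4, integral_add i12 i3, integral_add i1 i2,
    integral_const_mul, integral_const_mul, integral_const_mul, integral_const_mul]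

/-- The monomial integrals `I_ij = ∫ αⁱ βʲ`. [ours; bookkeeping] -/
def I40 : ℝ := ∫ x, α x ^ 4
/-- `I31 = ∫ α³β`. [ours; bookkeeping] -/
def I31 : ℝ := ∫ x, α x ^ 3 * β x
/-- `I22 = ∫ α²β²`. [ours; bookkeeping] -/
def I22 : ℝ := ∫ x, α x ^ 2 * β x ^ 2
/-- `I13 = ∫ αβ³`. [ours; bookkeeping] -/
def I13 : ℝ := ∫ x, α x * β x ^ 3
/-- `I04 = ∫ β⁴`. [ours; bookkeeping] -/
def I04 : ℝ := ∫ x, β x ^ 4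

/-- The quartic `g(t) = π⁴ (I40 + 4s I31 + 6s² I22 + 4s³ I13 + s⁴ I04)`, `s = (2π)² t`, written in powers
of `t`. [ours; bookkeeping] -/
def gPoly (t : ℝ) : ℝ :=
  Real.pi ^ 4 * I40 + (Real.pi ^ 4 * (4 * (2 * Real.pi) ^ 2 * I31)) * t +
    (Real.pi ^ 4 * (6 * ((2 * Real.pi) ^ 2) ^ 2 * I22)) * t ^ 2 +
      (Real.pi ^ 4 * (4 * ((2 * Real.pi) ^ 2) ^ 3 * I13)) * t ^ 3 + (Real.pi ^ 4 * ((2 * Real.pi) ^ 2) ^ 4 * I04) * t ^ 4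

/-- `∫ (π α + t (2π)²π β)⁴ = gPoly t`. [ours] -/
theorem integral_line_eq (t : ℝ) :
    ∫ x, (Real.pi * α x + t * ((2 * Real.pi) ^ 2 * Real.pi * β x)) ^ 4 = gPoly t := by
  have e : ∀ x, (Real.pi * α x + t * ((2 * Real.pi) ^ 2 * Real.pi * β x)) ^ 4 =
      Real.pi ^ 4 * (α x + ((2 * Real.pi) ^ 2 * t) * β x) ^ 4 := fun x => by ring
  simp_rw [e]
  rw [integral_const_mul, integral_add_mul_pow_four continuous_αβ.1 continuous_αβ.2]
  simp only [gPoly, I40, I31, I22, I13, I04]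
  ring

/-- **`∫(λ₁⁺)⁴(u + tΔu) = gPoly t`** and the same for `∫((−λ₃)⁺)⁴`. [ours] -/
theorem topEigMoment_line (t : ℝ) :
    torusTopEigMoment 4 (u + t • Torus.laplacian u) = gPoly t ∧
      torusNegBotEigMoment 4 (u + t • Torus.laplacian u) = gPoly t := by
  have h4 : (4 : ℝ) = ((4 : ℕ) : ℝ) := by norm_num
  constructor
  · rw [← integral_line_eq t]
    unfold torusTopEigMoment
    refine integral_congr_ae (ae_of_all _ fun x => ?_)
    obtain ⟨h1, -, h3, -⟩ := lam_pow_four_line t x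
    dsimp only
    rw [← lam_strainFlat, max_eq_left h3, h4, Real.rpow_natCast, h1]
  · rw [← integral_line_eq t]
    unfold torusNegBotEigMoment
    refine integral_congr_ae (ae_of_all _ fun x => ?_)
    obtain ⟨-, h2, -, h4'⟩ := lam_pow_four_line t x
    dsimp only
    rw [← lam_neg_strainFlat, max_eq_left h4', h4, Real.rpow_natCast, h2]

/-- **`heatDissipation (∫(λ₁⁺)⁴) u = −4(2π)²π⁴ I31`** (minus the right derivative of `gPoly` at `0`),
and the same for the `−λ₃` core. [ours] -/
theorem heatDissipation_eq_I31 :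
    heatDissipation (torusTopEigMoment 4) u = -(Real.pi ^ 4 * (4 * (2 * Real.pi) ^ 2 * I31)) ∧
      heatDissipation (torusNegBotEigMoment 4) u = -(Real.pi ^ 4 * (4 * (2 * Real.pi) ^ 2 * I31)) := by
  have hq : (1 : ℝ) ≤ 4 := by norm_num
  -- the derivative of a quartic at `0` is its linear coefficient (kept local: the generic lemma
  -- already exists elsewhere in the tree under an unrelated import)
  have hquart : ∀ c0 c1 c2 c3 c4 : ℝ,
      HasDerivAt (fun t : ℝ => c0 + c1 * t + c2 * t ^ 2 + c3 * t ^ 3 + c4 * t ^ 4) c1 0 := by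
    intro c0 c1 c2 c3 c4
    have h1 := (hasDerivAt_id (0 : ℝ)).const_mul c1
    have h2 := (hasDerivAt_pow 2 (0 : ℝ)).const_mul c2
    have h3 := (hasDerivAt_pow 3 (0 : ℝ)).const_mul c3
    have h4 := (hasDerivAt_pow 4 (0 : ℝ)).const_mul c4
    have h := ((((hasDerivAt_const (0 : ℝ) c0).add h1).add h2).add h3).add h4
    have e : (fun t : ℝ => c0 + c1 * t + c2 * t ^ 2 + c3 * t ^ 3 + c4 * t ^ 4) =
        (((((fun _ : ℝ => c0) + fun y : ℝ => c1 * id y) + fun y : ℝ => c2 * y ^ 2) +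
          fun y : ℝ => c3 * y ^ 3) + fun y : ℝ => c4 * y ^ 4) := by
      funext t; simp only [Pi.add_apply, id]
    rw [e]
    exact h.congr_deriv (by norm_num)
  have hg : HasDerivAt gPoly (Real.pi ^ 4 * (4 * (2 * Real.pi) ^ 2 * I31)) 0 := hquart _ _ _ _ _
  constructor
  · have e : (fun t : ℝ => torusTopEigMoment 4 (u + t • Torus.laplacian u)) = gPoly :=
      funext fun t => (topEigMoment_line t).1
    rw [(heatDissipation_topEigMoment_eq hq isSmooth_u).2, e,
      hg.hasDerivWithinAt.derivWithin (uniqueDiffWithinAt_Ioi 0)]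
  · have e : (fun t : ℝ => torusNegBotEigMoment 4 (u + t • Torus.laplacian u)) = gPoly :=
      funext fun t => (topEigMoment_line t).2
    rw [(heatDissipation_negBotEigMoment_eq hq isSmooth_u).2, e,
      hg.hasDerivWithinAt.derivWithin (uniqueDiffWithinAt_Ioi 0)]

/-! ## 5. Exact values of `I40`, `I31` from the tables -/

/-- Table of `α⁴`. [ours; bookkeeping] -/
def M40 : TP := mulC (mulC (TP.D 2 L0) (TP.D 2 L0)) (mulC (TP.D 2 L0) (TP.D 2 L0))

/-- Table of `α³β`. [ours; bookkeeping] -/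
def M31 : TP := mulC (mulC (TP.D 2 L0) (TP.D 2 L0)) (mulC (TP.D 2 L0) (TP.D 2 (TP.lapT L0)))

/-- `∫ α⁴ = 2957/8748` (zero mode of `M40`). [ours; by `decide`] -/
theorem coeff0_M40 : coeff0 M40 = ⟨2957 / 8748, 0⟩ := by decide +kernel

/-- `∫ α³β = −293/972` (zero mode of `M31`). [ours; by `decide`] -/
theorem coeff0_M31 : coeff0 M31 = ⟨-293 / 972, 0⟩ := by decide +kernel

/-- **`I40 = 2957/8748`, `I31 = −293/972`.** [ours] -/
theorem I40_I31_eq : I40 = 2957 / 8748 ∧ I31 = -293 / 972 := by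
  have hA : IsReal (TP.D 2 L0) := isReal_L0.D 2
  have hB : IsReal (TP.D 2 (TP.lapT L0)) := isReal_L0.lapT.D 2
  constructor
  · have e : ∀ x, α x ^ 4 = evalR M40 x := fun x => by
      simp only [α, M40, evalR_mulC (hA.mulC hA) (hA.mulC hA), evalR_mulC hA hA]; ring
    unfold I40
    simp_rw [e]
    rw [integral_evalR, coeff0_M40]; norm_num
  · have e : ∀ x, α x ^ 3 * β x = evalR M31 x := fun x => by
      simp only [α, β, M31, evalR_mulC (hA.mulC hA) (hA.mulC hB), evalR_mulC hA hA, evalR_mulC hA hB]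
      ring
    unfold I31
    simp_rw [e]
    rw [integral_evalR, coeff0_M31]; norm_num

/-! ## 6. The rate: `heatDissipation = (2637/2957)·16π² · moment` for both cores; the rate bounds -/

/-- **The moments of `u`**: `∫(λ₁⁺)⁴(u) = ∫((−λ₃)⁺)⁴(u) = π⁴ · 2957/8748 > 0`. [ours] -/
theorem topEigMoment_four_u :
    torusTopEigMoment 4 u = Real.pi ^ 4 * (2957 / 8748) ∧
      torusNegBotEigMoment 4 u = Real.pi ^ 4 * (2957 / 8748) ∧ 0 < Real.pi ^ 4 * (2957 / 8748 : ℝ) := by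
  have h0 : gPoly 0 = Real.pi ^ 4 * (2957 / 8748) := by
    simp only [gPoly, I40_I31_eq.1]; ring
  have h := topEigMoment_line 0
  simp only [zero_smul, add_zero] at h
  exact ⟨h.1.trans h0, h.2.trans h0, by positivity⟩

/-- **Exact heat dissipation of the laminate**:
`heatDissipation (∫(λ₁⁺)⁴) u = (2637/2957) · (16π²) · ∫(λ₁⁺)⁴(u)` (`R₄(u) ≈ 3.567 · 4π²`), and
the same for the `−λ₃` core. [ours, calibration] -/
theorem heatDissipation_topEigMoment_four_u :
    heatDissipation (torusTopEigMoment 4) u = 2637 / 2957 * (16 * Real.pi ^ 2) * torusTopEigMoment 4 u ∧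
      heatDissipation (torusNegBotEigMoment 4) u =
        2637 / 2957 * (16 * Real.pi ^ 2) * torusNegBotEigMoment 4 u := by
  obtain ⟨hT, hB, -⟩ := topEigMoment_four_u
  obtain ⟨dT, dB⟩ := heatDissipation_eq_I31
  rw [hT, hB, dT, dB, I40_I31_eq.2]
  constructor <;> ring

/-- **The rate of Lemma L-λ(4) is at most `(2637/2957)·16π²`: `TopEigHeatCoercive 4 c →
c ≤ (2637/2957)·(16π²)`** (witness: the two-mode laminate `u`). [ours, calibration] -/
theorem topEigHeatCoercive_four_rate_le {c : ℝ} (h : TopEigHeatCoercive (d := Fin 3) 4 c) :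
    c ≤ 2637 / 2957 * (16 * Real.pi ^ 2) := by
  obtain ⟨hT, -, hpos⟩ := topEigMoment_four_u
  have hL := h (by simp) u isSmooth_u isDivFree_u hasZeroMean_u
  rw [heatDissipation_topEigMoment_four_u.1, hT] at hL
  exact le_of_mul_le_mul_right hL hpos

/-- **Hence strictly below the single-shell value `4 · 4π² = 16π²`** of `TopEigHeatCoerciveRate`:
`TopEigHeatCoercive 4 c → c < 16π²`. [ours, calibration] -/
theorem topEigHeatCoercive_four_rate_lt {c : ℝ} (h : TopEigHeatCoercive (d := Fin 3) 4 c) :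
    c < 16 * Real.pi ^ 2 := by
  have h1 := topEigHeatCoercive_four_rate_le h
  have h2 : 2637 / 2957 * (16 * Real.pi ^ 2) < 16 * Real.pi ^ 2 := by
    have : 0 < 16 * Real.pi ^ 2 := by positivity
    nlinarith
  exact lt_of_le_of_lt h1 h2

/-- No rate above `(2637/2957)·16π²` is admissible at `q = 4`. [ours, calibration] -/
theorem not_topEigHeatCoercive_four_of_lt {c : ℝ} (hc : 2637 / 2957 * (16 * Real.pi ^ 2) < c) :
    ¬ TopEigHeatCoercive (d := Fin 3) 4 c := fun h =>
  absurd (topEigHeatCoercive_four_rate_le h) (not_le.2 hc)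

/-- **The `−λ₃` core: `NegBotEigHeatCoercive 4 c → c ≤ (2637/2957)·(16π²)`.** [ours, calibration] -/
theorem negBotEigHeatCoercive_four_rate_le {c : ℝ} (h : NegBotEigHeatCoercive (d := Fin 3) 4 c) :
    c ≤ 2637 / 2957 * (16 * Real.pi ^ 2) := by
  obtain ⟨-, hB, hpos⟩ := topEigMoment_four_u
  have hL := h (by simp) u isSmooth_u isDivFree_u hasZeroMean_u
  rw [heatDissipation_topEigMoment_four_u.2, hB] at hL
  exact le_of_mul_le_mul_right hL hpos

/-- `NegBotEigHeatCoercive 4 c → c < 16π²`. [ours, calibration] -/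
theorem negBotEigHeatCoercive_four_rate_lt {c : ℝ} (h : NegBotEigHeatCoercive (d := Fin 3) 4 c) :
    c < 16 * Real.pi ^ 2 := by
  have h1 := negBotEigHeatCoercive_four_rate_le h
  have h2 : 2637 / 2957 * (16 * Real.pi ^ 2) < 16 * Real.pi ^ 2 := by
    have : 0 < 16 * Real.pi ^ 2 := by positivity
    nlinarith
  exact lt_of_le_of_lt h1 h2

/-! ## 7. The dictionary's constant `C_λ(4) = topEigHeatRate 4` -/

/-- **`C_λ(4) ≤ (2637/2957)·16π²`.** [ours, calibration] -/
theorem topEigHeatRate_four_le : topEigHeatRate 4 ≤ 2637 / 2957 * (16 * Real.pi ^ 2) :=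
  topEigHeatCoercive_four_rate_le (topEigHeatCoercive_topEigHeatRate (by norm_num))

/-- **`C_λ(4) < 16π²`**: the single-shell rate is not the best constant of Lemma L-λ(4). [ours, calibration] -/
theorem topEigHeatRate_four_lt : topEigHeatRate 4 < 16 * Real.pi ^ 2 :=
  topEigHeatCoercive_four_rate_lt (topEigHeatCoercive_topEigHeatRate (by norm_num))

/-- **KERNEL WINDOW `C_λ(4) ∈ [0, (2637/2957)·16π²]`** (lower end: `TopEigHeatStable`). [ours, calibration] -/
theorem topEigHeatRate_four_mem_Icc : topEigHeatRate 4 ∈ Icc 0 (2637 / 2957 * (16 * Real.pi ^ 2)) :=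
  ⟨topEigHeatRate_nonneg (by norm_num), topEigHeatRate_four_le⟩

/-- The same window for the `−λ₃` constant (`negBotEigHeatRate 4 = C_λ(4)`). [ours, calibration] -/
theorem negBotEigHeatRate_four_le : negBotEigHeatRate 4 ≤ 2637 / 2957 * (16 * Real.pi ^ 2) := by
  rw [negBotEigHeatRate_eq]; exact topEigHeatRate_four_le

end TopEigLaminate

end Summit.NavierStokesRegularity.FunctionalMining

end
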